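import Mathlib.Algebra.Polynomial.Taylor
import Mathlib.Algebra.Polynomial.HasseDeriv
import Mathlib.RingTheory.Polynomial.Pochhammer
import Mathlib.Data.Nat.Choose.Basic
import Mathlib.Tactic
import HarnessLib

/-!
# Small value estimates at rational translates (Nguyen–Roy 2016) — proofs, IX: Hilbert-function numerics

Ninth proofs file towards `Literature.NumberTheory.Transcendental.nguyenRoy2016_thm_1` (Nguyen–Roy,
IJNT 12 (2016) = arXiv:1412.5163). The proof of that theorem rests on D. Roy's "translation" version
of his multiplicity estimate for the resultant (Roy, *A small value estimate for 𝔾ₐ × 𝔾ₘ*,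
Mathematika 59 (2013) = arXiv:1301.0663 [R2013 below], §5), whose first step is the Hilbert-function
computation of **R2013 Lemma 5.1**: if `P₀, …, P_m ∈ ℂ[X₀,…,X_m]_D` is a regular sequence then,
with `E₀(ν) = ℂ[X]_ν` and `dim E_{j+1}(ν) = dim E_j(ν) − dim E_j(ν − D)` (R2013 (5.3)), one has
`dim E_m(ν) = D^m` for `ν ≥ mD − m` and `E_{m+1}(ν) = 0` for `ν ≥ (m+1)D − m`.

This file PROVES the purely numerical half of that lemma, isolated from the commutative algebra:
the integer sequence `NguyenRoy.hilbSeq m D j ν` defined by `hilbSeq m D 0 ν = C(ν+m, m)` (`= 0` for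
`ν < 0`) and the recursion (5.3) satisfies

* `NguyenRoy.hilbSeq_self`      : `hilbSeq m D m ν = D^m` for `ν ≥ mD − m`;
* `NguyenRoy.hilbSeq_succ_self` : `hilbSeq m D (m+1) ν = 0` for `ν ≥ (m+1)D − m`;
* `NguyenRoy.hilbSeq_eq_eval`   : for `ν ≥ jD − m`, `hilbSeq m D j ν = (Δ_D^j C(X+m, m))(ν)`.

The argument is the one indicated in R2013 (proof of Lemma 5.1, by induction from `dim E₀(ν) = (ν+m)⋯(ν+1)/m!` for `ν ≥ −m`): for
`ν ≥ jD − m` the sequence is the `j`-th backward difference with step `D` (`NguyenRoy.bdiff`) of the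
polynomial `C(X+m, m) ∈ ℚ[X]` (`NguyenRoy.binomPoly`), of degree `m` and leading coefficient `1/m!`;
each difference lowers the degree by one and multiplies the relevant coefficient by `(deg)·D`
(`NguyenRoy.natDegree_bdiff_le`, `NguyenRoy.coeff_bdiff`, through `Polynomial.taylor_coeff`), so
`Δ_D^m C(X+m,m) = D^m` and `Δ_D^{m+1} C(X+m,m) = 0`.

Definitions here (`bdiff`, `binomPoly`, `hilbSeq`) are plumbing with bodies; no named facts.

## References

* [Roy2013] D. Roy, *A small value estimate for 𝔾ₐ × 𝔾ₘ*, Mathematika 59 (2013) 333–363 =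
  arXiv:1301.0663, §5: Lemma 5.1, its proof, and formulas (5.1)–(5.3) (p. 13 of the arXiv text).
* [NguyenRoy2016] N. A. V. Nguyen, D. Roy, IJNT 12 (2016) = arXiv:1412.5163, §4 (which imports the
  results of R2013 §5 in the form of Prop. 14).
-/

noncomputable section

open Polynomial Finset

namespace Literature.NumberTheory.Transcendental

namespace NguyenRoy

/-! ## Backward differences of polynomials -/

/-- The backward difference with step `D`: `Δ_D q = q(X) − q(X − D)`. [folklore] -/
def bdiff (D : ℚ) (q : ℚ[X]) : ℚ[X] := q - q.comp (X - C D)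

/-- `(Δ_D q)(x) = q(x) − q(x − D)`. [folklore] -/
theorem eval_bdiff (D : ℚ) (q : ℚ[X]) (x : ℚ) :
    (bdiff D q).eval x = q.eval x - q.eval (x - D) := by
  simp [bdiff, eval_comp]

/-- `Δ_D` of a constant vanishes. [folklore] -/
theorem bdiff_C (D a : ℚ) : bdiff D (C a) = 0 := by
  simp [bdiff]

/-- The coefficients of `q(X − D)` are values of Hasse derivatives (Taylor expansion). [folklore] -/
theorem coeff_comp_X_sub_C (q : ℚ[X]) (D : ℚ) (k : ℕ) :
    (q.comp (X - C D)).coeff k = (hasseDeriv k q).eval (-D) := by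
  rw [sub_eq_add_neg, ← C_neg, ← taylor_apply, taylor_coeff]

/-- `Δ_D` lowers the degree: `deg q ≤ n + 1 ⇒ deg Δ_D q ≤ n`. [folklore] -/
theorem natDegree_bdiff_le {q : ℚ[X]} {n : ℕ} (hq : q.natDegree ≤ n + 1) (D : ℚ) :
    (bdiff D q).natDegree ≤ n := by
  refine (natDegree_le_iff_coeff_eq_zero).mpr fun k hk => ?_
  rw [bdiff, coeff_sub, coeff_comp_X_sub_C]
  rcases (Nat.succ_le_of_lt hk).eq_or_lt with h | h
  · subst h
    have h0 : (hasseDeriv (n + 1) q).natDegree ≤ 0 := by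
      have := natDegree_hasseDeriv_le q (n + 1); omega
    rw [eq_C_of_natDegree_le_zero h0, eval_C, hasseDeriv_coeff, zero_add, Nat.choose_self,
      Nat.cast_one, one_mul, sub_self]
  · rw [hasseDeriv_eq_zero_of_lt_natDegree q k (by omega), eval_zero, sub_zero]
    exact coeff_eq_zero_of_natDegree_lt (by omega)

/-- The next coefficient of `Δ_D q`: if `deg q ≤ n + 1` then `[X^n] Δ_D q = (n+1) D [X^{n+1}] q`.
[folklore] -/
theorem coeff_bdiff {q : ℚ[X]} {n : ℕ} (hq : q.natDegree ≤ n + 1) (D : ℚ) :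
    (bdiff D q).coeff n = (n + 1) * D * q.coeff (n + 1) := by
  rw [bdiff, coeff_sub, coeff_comp_X_sub_C]
  have h1 : (hasseDeriv n q).natDegree < 2 := by
    have := natDegree_hasseDeriv_le q n; omega
  rw [eval_eq_sum_range' h1]
  simp only [sum_range_succ, sum_range_zero, hasseDeriv_coeff, zero_add, Nat.choose_self,
    Nat.cast_one, one_mul, pow_zero, mul_one, pow_one]
  rw [show 1 + n = n + 1 from add_comm 1 n, Nat.choose_succ_self_right]
  push_cast
  ring

/-! ## The binomial polynomial `C(X+m, m)` and its differences -/

/-- `binomPoly m = C(X + m, m) = (X+m)(X+m−1)⋯(X+1)/m! ∈ ℚ[X]`, the Hilbert polynomial of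
`ℂ[X₀,…,X_m]`. [folklore] -/
def binomPoly (m : ℕ) : ℚ[X] :=
  C ((m.factorial : ℚ)⁻¹) * (descPochhammer ℚ m).comp (X + C (m : ℚ))

/-- `(X+m)(X+m−1)⋯(X+1)` is monic of degree `m`. [folklore] -/
theorem monic_descPochhammer_comp (m : ℕ) :
    ((descPochhammer ℚ m).comp (X + C (m : ℚ))).Monic ∧
      ((descPochhammer ℚ m).comp (X + C (m : ℚ))).natDegree = m := by
  have hX : (X + C (m : ℚ)).Monic := monic_X_add_C _
  have hX1 : (X + C (m : ℚ)).natDegree = 1 := natDegree_X_add_C _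
  refine ⟨(monic_descPochhammer ℚ m).comp hX (by rw [hX1]; exact one_ne_zero), ?_⟩
  rw [natDegree_comp, descPochhammer_natDegree, hX1, mul_one]

/-- `deg C(X+m, m) ≤ m`. [folklore] -/
theorem natDegree_binomPoly_le (m : ℕ) : (binomPoly m).natDegree ≤ m := by
  obtain ⟨-, h2⟩ := monic_descPochhammer_comp m
  unfold binomPoly
  calc (C ((m.factorial : ℚ)⁻¹) * (descPochhammer ℚ m).comp (X + C (m : ℚ))).natDegree
      ≤ (C ((m.factorial : ℚ)⁻¹)).natDegree +
          ((descPochhammer ℚ m).comp (X + C (m : ℚ))).natDegree := natDegree_mul_le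
    _ = m := by rw [natDegree_C, h2, zero_add]

/-- The leading coefficient of `C(X+m, m)` is `1/m!`. [folklore] -/
theorem coeff_binomPoly (m : ℕ) : (binomPoly m).coeff m = ((m.factorial : ℚ))⁻¹ := by
  obtain ⟨h1, h2⟩ := monic_descPochhammer_comp m
  unfold binomPoly
  rw [coeff_C_mul]
  have : ((descPochhammer ℚ m).comp (X + C (m : ℚ))).coeff m = 1 := by
    have h := h1.leadingCoeff
    rwa [Polynomial.leadingCoeff, h2] at h
  rw [this, mul_one]

/-- `C(X+m, m)` evaluated at an integer `ν ≥ −m` is the binomial coefficient `C(ν+m, m)` (which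
vanishes for `−m ≤ ν < 0`). [folklore] -/
theorem eval_binomPoly (m : ℕ) {ν : ℤ} {n : ℕ} (hν : ν + m = n) :
    (binomPoly m).eval (ν : ℚ) = (n.choose m : ℚ) := by
  unfold binomPoly
  rw [eval_mul, eval_C, eval_comp, eval_add, eval_X, eval_C]
  have hcast : (ν : ℚ) + (m : ℚ) = ((n : ℕ) : ℚ) := by exact_mod_cast hν
  rw [hcast, descPochhammer_eval_eq_descFactorial, Nat.descFactorial_eq_factorial_mul_choose]
  have hf : (m.factorial : ℚ) ≠ 0 := by exact_mod_cast m.factorial_ne_zero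
  push_cast
  field_simp

/-- The `j`-th difference of `C(X+m, m)` (`j ≤ m`) has degree `≤ m − j` and coefficient
`D^j/(m−j)!` in degree `m − j`. [folklore] -/
theorem iterate_bdiff_binomPoly (m : ℕ) (D : ℚ) {j : ℕ} (hj : j ≤ m) :
    ((bdiff D)^[j] (binomPoly m)).natDegree ≤ m - j ∧
      ((bdiff D)^[j] (binomPoly m)).coeff (m - j) = D ^ j * (((m - j).factorial : ℚ))⁻¹ := by
  induction j with
  | zero =>
    simp only [Function.iterate_zero, id_eq, Nat.sub_zero, pow_zero, one_mul]
    exact ⟨natDegree_binomPoly_le m, coeff_binomPoly m⟩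
  | succ j ih =>
    obtain ⟨h1, h2⟩ := ih (by omega)
    rw [Function.iterate_succ_apply']
    have e : m - j = (m - (j + 1)) + 1 := by omega
    rw [e] at h1 h2
    refine ⟨natDegree_bdiff_le h1 D, ?_⟩
    rw [coeff_bdiff h1, h2, Nat.factorial_succ]
    have hf : (((m - (j + 1)).factorial : ℕ) : ℚ) ≠ 0 := by exact_mod_cast (m - (j + 1)).factorial_ne_zero
    have hs : ((m - (j + 1) : ℕ) : ℚ) + 1 ≠ 0 := by positivity
    push_cast
    field_simp
    ring

/-- `Δ_D^m C(X+m, m) = D^m` (a constant). [folklore] -/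
theorem iterate_bdiff_binomPoly_self (m : ℕ) (D : ℚ) :
    (bdiff D)^[m] (binomPoly m) = C (D ^ m) := by
  obtain ⟨h1, h2⟩ := iterate_bdiff_binomPoly m D le_rfl
  rw [Nat.sub_self] at h1 h2
  rw [eq_C_of_natDegree_le_zero h1, h2, Nat.factorial_zero, Nat.cast_one, inv_one, mul_one]

/-- `Δ_D^{m+1} C(X+m, m) = 0`. [folklore] -/
theorem iterate_bdiff_binomPoly_succ (m : ℕ) (D : ℚ) :
    (bdiff D)^[m + 1] (binomPoly m) = 0 := by
  rw [Function.iterate_succ_apply', iterate_bdiff_binomPoly_self, bdiff_C]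

/-! ## The Hilbert-function sequence of R2013 Lemma 5.1 -/

/-- The numerics of [R2013, Lemma 5.1]: `hilbSeq m D j ν = dim E_j(ν)`, i.e.
`hilbSeq m D 0 ν = dim ℂ[X₀,…,X_m]_ν = C(ν+m, m)` (`0` for `ν < 0`) and the recursion (5.3)
`hilbSeq m D (j+1) ν = hilbSeq m D j ν − hilbSeq m D j (ν − D)`. [cite: Roy2013, Lemma 5.1 and (5.3)] -/
def hilbSeq (m D : ℕ) : ℕ → ℤ → ℤ
  | 0, ν => if ν < 0 then 0 else (((ν.toNat + m).choose m : ℕ) : ℤ)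
  | j + 1, ν => hilbSeq m D j ν - hilbSeq m D j (ν - D)

/-- Unfolding the base case. [folklore] -/
theorem hilbSeq_zero (m D : ℕ) (ν : ℤ) :
    hilbSeq m D 0 ν = if ν < 0 then 0 else (((ν.toNat + m).choose m : ℕ) : ℤ) := rfl

/-- Unfolding the recursion (5.3). [folklore] -/
theorem hilbSeq_succ (m D j : ℕ) (ν : ℤ) :
    hilbSeq m D (j + 1) ν = hilbSeq m D j ν - hilbSeq m D j (ν - D) := rfl

/-- The sequence vanishes in negative degrees. [folklore] -/
theorem hilbSeq_of_neg (m D : ℕ) {ν : ℤ} (hν : ν < 0) : ∀ j, hilbSeq m D j ν = 0 := by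
  intro j
  induction j generalizing ν with
  | zero => simp [hilbSeq_zero, hν]
  | succ j ih =>
    rw [hilbSeq_succ, ih hν, ih (by omega), sub_zero]

/-- The base value `hilbSeq m D 0 ν = C(ν+m, m)` for `ν ≥ 0`. [folklore] -/
theorem hilbSeq_zero_of_nonneg (m D : ℕ) (n : ℕ) :
    hilbSeq m D 0 (n : ℤ) = (((n + m).choose m : ℕ) : ℤ) := by
  simp [hilbSeq_zero]

/-- **For `ν ≥ jD − m` the sequence is polynomial**: `hilbSeq m D j ν = (Δ_D^j C(X+m,m))(ν)`.
[cite: Roy2013, proof of Lemma 5.1] -/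
theorem hilbSeq_eq_eval (m D j : ℕ) (ν : ℤ) (hν : (j : ℤ) * D - m ≤ ν) :
    (hilbSeq m D j ν : ℚ) = ((bdiff (D : ℚ))^[j] (binomPoly m)).eval (ν : ℚ) := by
  induction j generalizing ν with
  | zero =>
    simp only [Nat.cast_zero, zero_mul, zero_sub, neg_le_iff_add_nonneg] at hν
    rw [Function.iterate_zero, id_eq,
      eval_binomPoly m (n := (ν + m).toNat) (Int.toNat_of_nonneg (by linarith)).symm,
      hilbSeq_zero]
    split_ifs with h
    · rw [Nat.choose_eq_zero_of_lt (by omega)]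
      simp
    · push_cast
      congr 2
      omega
  | succ j ih =>
    have hν1 : (j : ℤ) * D - m ≤ ν := by push_cast at hν; nlinarith
    have hν2 : (j : ℤ) * D - m ≤ ν - D := by push_cast at hν; linarith
    rw [hilbSeq_succ, Function.iterate_succ_apply', eval_bdiff, Int.cast_sub, ih ν hν1, ih (ν - D) hν2]
    push_cast
    ring_nf

/-- **R2013 Lemma 5.1, numerics, first half**: `dim E_m(ν) = D^m` for `ν ≥ mD − m`.
[cite: Roy2013, Lemma 5.1] -/
theorem hilbSeq_self (m D : ℕ) (ν : ℤ) (hν : (m : ℤ) * D - m ≤ ν) :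
    hilbSeq m D m ν = (D : ℤ) ^ m := by
  have h := hilbSeq_eq_eval m D m ν hν
  rw [iterate_bdiff_binomPoly_self, eval_C] at h
  exact_mod_cast h

/-- **R2013 Lemma 5.1, numerics, second half**: `E_{m+1}(ν) = 0` for `ν ≥ (m+1)D − m`.
[cite: Roy2013, Lemma 5.1] -/
theorem hilbSeq_succ_self (m D : ℕ) (ν : ℤ) (hν : ((m : ℤ) + 1) * D - m ≤ ν) :
    hilbSeq m D (m + 1) ν = 0 := by
  have h := hilbSeq_eq_eval m D (m + 1) ν (by push_cast; linarith)
  rw [iterate_bdiff_binomPoly_succ, eval_zero] at h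
  exact_mod_cast h

/-- The recursion in the range `0 ≤ ν < D`, where `ν − D < 0`: `hilbSeq m D (j+1) ν = hilbSeq m D j ν`.
[folklore] -/
theorem hilbSeq_succ_of_lt (m D j : ℕ) {ν : ℤ} (hν : ν < D) :
    hilbSeq m D (j + 1) ν = hilbSeq m D j ν := by
  rw [hilbSeq_succ, hilbSeq_of_neg m D (ν := ν - D) (by omega) j, sub_zero]

end NguyenRoy

end Literature.NumberTheory.Transcendental
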